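import Summits.ResolutionOfSingularities.ResolutionOfSingularities.Theorems.HilbertSamuelEliminationCampaignW42FibreConePresentation
import Summits.ResolutionOfSingularities.ResolutionOfSingularities.Theorems.HilbertSamuelEliminationCampaignW42ConeRidgePrime
import Literature.AlgebraicGeometry.Resolution.BlowupChartRsop
import HarnessLib

/-!
# [OURS · L1 W4.2] The point of a blow-up chart read in the coordinate fibre cone: the homogeneous prime
# `𝔓(P) ⊆ k[Y_1, …, Y_n]` of a prime `P` of `𝒪[𝔭/c_j]`, its forms (`Ḡ ∈ 𝔓(P) ⟺ G(c/c_j) ∈ P`), its local ring and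
# its dimension (campaign s42, cell res-hironaka; informal crux `RidgeConfinement`, stmt-ResolutionOfSingularities-17845;
# `--supports`)

HONEST FRAMING. OURS (slot W4.2, prover res-L1-s42-pv-1, gen 3): the dictionary that lets the cone theorem at an arbitrary
point (`…CampaignW42ConeRidgePrime.lean`) be applied to the line of the fibre cone `C_{X,D,x}` spanned by a point `x' ↔ P`
of the blow-up chart `C = 𝒪[𝔭/c_j]` (`Resolution.chartRing c j`), `𝔭 = (c_1, …, c_n)`, `P` over `𝔫`. With
`S = k[Y_1, …, Y_n] ↠ FibreCone 𝔭` (`fibreConePolyMap c`, kernel `I(c) = fibreConeIdeal c`,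
`…CampaignW42FibreConePresentation.lean`) and the tree's `conePrime (c j) _ P ⊆ FibreCone 𝔭` /
`coneLocalPrime (c j) _ P ⊆ FibreConeLocal 𝔭` (`BlowupFibreConeModel.lean`):

* `CampaignW42.chartConePrime c j P = 𝔓(P) ⊆ k[Y]` — the pull-back of `conePrime` to the polynomial ring: a prime
  containing `I(c)` (`isPrime_chartConePrime`, `fibreConeIdeal_le_chartConePrime`), NOT containing `Y_j`
  (`X_notMem_chartConePrime`);
* **`map_residue_mem_chartConePrime_iff`** — for a form `G ∈ 𝒪[Y]` of degree `m`: `Ḡ ∈ 𝔓(P) ⟺ G(e_1, …, e_n) ∈ P`,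
  `e_l = c_l/c_j = chartGen c j l` (through `awayCoeff_reesPolyMap`: the `m`-th chart coefficient of `G(c t)` is `G(e)`);
* `isLocalization_atPrime_comap_of_ringEquiv` (transport of `IsLocalization.AtPrime` along a ring isomorphism of the base),
  `comap_fibreConeQuotEquiv_conePrime` (`𝔓(P)/I(c) ↔ conePrime` under `fibreConeQuotEquiv`), and
  **`isLocalization_atPrime_coneLocalPrime`**: `(FibreConeLocal 𝔭)_𝔮`, `𝔮 = coneLocalPrime`, IS a localization of
  `k[Y]/I(c)` at `𝔓(P)/I(c)` — the local ring `𝒪_{C,𝔓(P)}` of the coordinate cone;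
* **`ringKrullDim_quotient_chartConePrime_eq`**: `dim k[Y]/𝔓(P) = dim (FibreConeLocal 𝔭 ⧸ 𝔮)` (the `d` of the
  Bennett–Hironaka–Singh chain, `…CampaignW42PermissibleNearEqualities.lean`), through
  `ringKrullDim_localization_quotient_eq_ringKrullDim` (`dim 𝒪_{C,𝔮}/𝔓𝒪_{C,𝔮} = dim S/𝔓`, equidimensionality).

NOTHING here is a statement of H. Hironaka's manuscript [Hironaka2017]. AI review is weaker than expert review.
References (orientation only): V. Cossart, U. Jannsen, S. Saito, LNM 2270 (2020), proof of Thm. 3.10 (p. 46), (3.14);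
The Stacks Project, Tag 0804.
-/

noncomputable section

-- single-conjunct summit: the doubled namespace component `ResolutionOfSingularities` is mandated
set_option linter.dupNamespace false
-- quotients of localizations of `k[Y]/I` need one more level of nested instance synthesis (as in `…ConeRidgePrime`)
set_option maxSynthPendingDepth 3

open IsLocalRing MvPolynomial
open Literature.RingTheory.HilbertSamuel
open Literature.AlgebraicGeometry.Resolution

namespace Summit.ResolutionOfSingularities.ResolutionOfSingularities.Theorems

namespace CampaignW42

universe u

/-! ## Transport of `IsLocalization.AtPrime` along an isomorphism of the base -/

/-- If `L` is the localization of `B` at the prime `Q` and `e : A ≃ B`, then `L` (as an `A`-algebra through `e`) is the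
localization of `A` at `Q' = e⁻¹(Q)`. [folklore] -/
theorem isLocalization_atPrime_comap_of_ringEquiv {A B L : Type u} [CommRing A] [CommRing B] [CommRing L]
    (e : A ≃+* B) (Q : Ideal B) [Q.IsPrime] (Q' : Ideal A) [Q'.IsPrime] (hQ' : Q' = Q.comap e.toRingHom)
    [Algebra B L] [IsLocalization.AtPrime L Q] :
    letI : Algebra A L := ((algebraMap B L).comp e.toRingHom).toAlgebra
    IsLocalization.AtPrime L Q' := by
  letI : Algebra A L := ((algebraMap B L).comp e.toRingHom).toAlgebra
  have h := IsLocalization.isLocalization_of_base_ringEquiv Q.primeCompl L e.symm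
  subst hQ'
  have hM : Q.primeCompl.map e.symm = (Q.comap e.toRingHom).primeCompl := by
    ext x
    rw [Submonoid.mem_map]
    constructor
    · rintro ⟨y, hy, rfl⟩ hx
      exact hy (by simpa [Ideal.mem_comap] using hx)
    · intro hx
      exact ⟨e x, fun h' => hx (by simpa [Ideal.mem_comap] using h'), e.symm_apply_apply x⟩
  rw [hM] at h
  convert h using 1
  exact congrArg (fun f : A →+* B => ((algebraMap B L).comp f).toAlgebra) (by rfl)

/-! ## The homogeneous prime `𝔓(P) ⊆ k[Y]` of a point of the chart -/

section ChartCone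

variable {O : Type u} [CommRing O] [IsLocalRing O] {n : ℕ} (c : Fin n → O) (j : Fin n)

local notation3 "𝔭" => Ideal.span (Set.range c)
local notation3 "hcj" => Ideal.mem_span_range_self (f := c) (x := j)

variable (P : Ideal (chartRing c j))

/-- [OURS · L1 W4.2] **The homogeneous prime `𝔓(P) ⊆ k[Y_1, …, Y_n]` of the point `P` of the chart `𝒪[𝔭/c_j]`**: the
pull-back of the tree's `conePrime (c j) _ P ⊆ FibreCone 𝔭` (the prime of the fibre cone whose point of `Proj` is
`x' ↔ P`) along the presentation `fibreConePolyMap c`. NOT a statement of the manuscript. [folklore] -/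
def chartConePrime : Ideal (MvPolynomial (Fin n) (ResidueField O)) :=
  (conePrime (c j) hcj P).comap (fibreConePolyMap c)

/-- `I(c) ⊆ 𝔓(P)`. [folklore] -/
theorem fibreConeIdeal_le_chartConePrime : fibreConeIdeal c ≤ chartConePrime c j P := fun g hg => by
  rw [chartConePrime, Ideal.mem_comap, (RingHom.mem_ker.mp hg : fibreConePolyMap c g = 0)]
  exact zero_mem _

variable [P.IsPrime]

/-- `𝔓(P)` is prime (for `P` over `𝔫`). [folklore] -/
theorem isPrime_chartConePrime (hP : P.comap (chartBase c j) = maximalIdeal O) : (chartConePrime c j P).IsPrime :=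
  haveI := isPrime_conePrime (c j) hcj P hP
  Ideal.comap_isPrime _ _

/-- The pull-back of `conePrime` to the Rees ring is `chartPrime`. [folklore] -/
theorem comap_mk_conePrime (hP : P.comap (chartBase c j) = maximalIdeal O) :
    (conePrime (c j) hcj P).comap (Ideal.Quotient.mk (reesMaxExt (𝔭))) = chartPrime (c j) hcj P := by
  rw [conePrime, Ideal.comap_map_of_surjective _ Ideal.Quotient.mk_surjective, ← RingHom.ker_eq_comap_bot,
    Ideal.mk_ker, sup_eq_left]
  exact reesMaxExt_le_chartPrime (c j) hcj P hP

omit [IsLocalRing O] in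
/-- **The chart coefficients of `G(c t)`**: for a form `G` of degree `m`, the `m`-th coefficient
`(G(c) tᵐ)/(c_j t)ᵐ ∈ 𝒪[𝔭/c_j]` is `G(e_1, …, e_n)`, `e_l = chartGen c j l`; the others vanish. [folklore] -/
theorem awayCoeff_reesPolyMap {G : MvPolynomial (Fin n) O} {m : ℕ} (hG : G.IsHomogeneous m) :
    awayCoeff (c j) hcj (ReesRing.equiv (𝔭) (reesPolyMap c G)) m = eval₂ (chartBase c j) (chartGen c j) G := by
  set b := ReesRing.equiv (𝔭) (reesPolyMap c G) with hb
  have hcoe : (b : Polynomial O) = Polynomial.monomial m (eval c G) := poly_reesPolyMap_of_isHomogeneous c hG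
  have hcomp : reesComponent b m = b := Subtype.ext (by rw [coe_reesComponent, hcoe, Polynomial.coeff_monomial, if_pos rfl])
  have hmem : b ∈ reesGrading (𝔭) (m • 1) := by rw [← hcomp]; exact reesComponent_mem' b m
  -- `φ(G(c)) = φ(c_j)^m · awayCoeff` and `φ(G(c)) = φ(c_j)^m · G(e)`
  have h1 : chartBase c j (eval c G) = chartBase c j (c j) ^ m * awayCoeff (c j) hcj b m := by
    rw [reesChartBase_eq_pow_mul_mk c j hmem hcoe]
    congr 1
    unfold awayCoeff
    congr 1
    exact hcomp.symm
  have h2 : chartBase c j (eval c G) = chartBase c j (c j) ^ m * eval₂ (chartBase c j) (chartGen c j) G := by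
    letI : Algebra O (chartRing c j) := (chartBase c j).toAlgebra
    have hce : (fun l => chartBase c j (c l)) = chartBase c j (c j) • chartGen c j := by
      funext l
      exact reesChartBase_apply_eq_mul_chartGen c j l
    have h := aeval_smul_of_isHomogeneous hG (chartBase c j (c j)) (chartGen c j)
    rw [← hce] at h
    change eval₂ (chartBase c j) (fun l => chartBase c j (c l)) G =
      chartBase c j (c j) ^ m * eval₂ (chartBase c j) (chartGen c j) G at h
    rw [← h]
    change chartBase c j (eval₂ (RingHom.id O) c G) = _
    rw [hom_eval₂, RingHom.comp_id]
  have hnzd : chartBase c j (c j) ^ m ∈ nonZeroDivisors (chartRing c j) :=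
    pow_mem (reesChartBase_mem_nonZeroDivisors (c j) hcj) m
  rw [h1] at h2
  exact (mul_cancel_left_mem_nonZeroDivisors hnzd).mp h2

omit [IsLocalRing O] in
/-- The other chart coefficients of `G(c t)` vanish. [folklore] -/
theorem awayCoeff_reesPolyMap_of_ne {G : MvPolynomial (Fin n) O} {m : ℕ} (hG : G.IsHomogeneous m) {d : ℕ}
    (hd : d ≠ m) : awayCoeff (c j) hcj (ReesRing.equiv (𝔭) (reesPolyMap c G)) d = 0 := by
  refine awayCoeff_eq_zero (c j) hcj ?_
  change (ReesRing.poly (𝔭) (reesPolyMap c G)).coeff d = 0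
  rw [poly_reesPolyMap_of_isHomogeneous c hG, Polynomial.coeff_monomial, if_neg (Ne.symm hd)]

omit [IsLocalRing O] in
/-- **`G(c t) ∈ chartPrime P ⟺ G(e) ∈ P`** for a form `G` of degree `m`. [folklore] -/
theorem reesPolyMap_mem_chartPrime_iff {G : MvPolynomial (Fin n) O} {m : ℕ} (hG : G.IsHomogeneous m) :
    reesPolyMap c G ∈ chartPrime (c j) hcj P ↔ eval₂ (chartBase c j) (chartGen c j) G ∈ P := by
  rw [mem_chartPrime_iff_awayCoeff]
  constructor
  · intro h
    rw [← awayCoeff_reesPolyMap c j hG]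
    exact h m
  · intro h d
    by_cases hd : d = m
    · subst hd; rwa [awayCoeff_reesPolyMap c j hG]
    · rw [awayCoeff_reesPolyMap_of_ne c j hG hd]; exact zero_mem _

/-- **`Ḡ ∈ 𝔓(P) ⟺ G(e_1, …, e_n) ∈ P`** for a form `G ∈ 𝒪[Y]` of degree `m` with reduction `Ḡ ∈ k[Y]`. [folklore] -/
theorem map_residue_mem_chartConePrime_iff (hP : P.comap (chartBase c j) = maximalIdeal O)
    {G : MvPolynomial (Fin n) O} {m : ℕ} (hG : G.IsHomogeneous m) :
    MvPolynomial.map (residue O) G ∈ chartConePrime c j P ↔ eval₂ (chartBase c j) (chartGen c j) G ∈ P := by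
  rw [chartConePrime, Ideal.mem_comap, fibreConePolyMap_map_residue, ← Ideal.mem_comap, comap_mk_conePrime c j P hP,
    reesPolyMap_mem_chartPrime_iff c j P hG]

/-- **`Y_j ∉ 𝔓(P)`** (`c_j t` is inverted on the chart). [folklore] -/
theorem X_notMem_chartConePrime (hP : P.comap (chartBase c j) = maximalIdeal O) : X j ∉ chartConePrime c j P := by
  have h : MvPolynomial.map (residue O) (X j : MvPolynomial (Fin n) O) = X j := map_X _ j
  rw [← h, map_residue_mem_chartConePrime_iff c j P hP (isHomogeneous_X O j), eval₂_X]
  intro hmem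
  have h1 : chartGen c j j = 1 := chartGen_self c j
  rw [h1] at hmem
  exact (Ideal.IsPrime.ne_top ‹P.IsPrime›) ((Ideal.eq_top_iff_one P).mpr hmem)

/-! ## The local ring of the coordinate cone at `𝔓(P)` -/

omit [P.IsPrime] in
/-- `𝔓(P)/I(c)` corresponds to `conePrime` under `fibreConeQuotEquiv`. [folklore] -/
theorem comap_fibreConeQuotEquiv_conePrime :
    (conePrime (c j) hcj P).comap (fibreConeQuotEquiv c).toRingHom =
      (chartConePrime c j P).map (Ideal.Quotient.mk (fibreConeIdeal c)) := by
  refine Ideal.comap_injective_of_surjective (Ideal.Quotient.mk (fibreConeIdeal c)) Ideal.Quotient.mk_surjective ?_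
  rw [Ideal.comap_comap, Ideal.comap_map_of_surjective _ Ideal.Quotient.mk_surjective, ← RingHom.ker_eq_comap_bot,
    Ideal.mk_ker, sup_eq_left.mpr (fibreConeIdeal_le_chartConePrime c j P)]
  have hcomp : (fibreConeQuotEquiv c).toRingHom.comp (Ideal.Quotient.mk (fibreConeIdeal c)) = fibreConePolyMap c :=
    RingHom.ext fun g => fibreConeQuotEquiv_mk c g
  rw [hcomp]
  rfl

/-- [OURS · L1 W4.2] The `k[Y]/I(c)`-algebra structure on a `FibreCone 𝔭`-algebra, through `fibreConeQuotEquiv`. NOT a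
statement of the manuscript. [folklore] -/
abbrev algebraOfFibreCone (L : Type u) [CommRing L] [Algebra (FibreCone (𝔭)) L] :
    Algebra (MvPolynomial (Fin n) (ResidueField O) ⧸ fibreConeIdeal c) L :=
  ((algebraMap (FibreCone (𝔭)) L).comp (fibreConeQuotEquiv c).toRingHom).toAlgebra

/-- **`(FibreConeLocal 𝔭)_𝔮`, `𝔮 = coneLocalPrime`, is the local ring `𝒪_{C,𝔓(P)}` of the coordinate cone**: a
localization of `k[Y]/I(c)` at `𝔓(P)/I(c)`. [folklore] -/
theorem isLocalization_atPrime_coneLocalPrime (hP : P.comap (chartBase c j) = maximalIdeal O) :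
    haveI := isPrime_coneLocalPrime (c j) hcj P hP
    haveI := isPrime_chartConePrime c j P hP
    haveI := isPrime_map_quotientMk_of_le (fibreConeIdeal_le_chartConePrime c j P)
    letI := algebraOfFibreCone c (Localization.AtPrime (coneLocalPrime (c j) hcj P))
    IsLocalization.AtPrime (Localization.AtPrime (coneLocalPrime (c j) hcj P))
      ((chartConePrime c j P).map (Ideal.Quotient.mk (fibreConeIdeal c))) := by
  haveI := isPrime_coneLocalPrime (c j) hcj P hP
  haveI := isPrime_conePrime (c j) hcj P hP
  haveI := isPrime_chartConePrime c j P hP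
  haveI := isPrime_map_quotientMk_of_le (fibreConeIdeal_le_chartConePrime c j P)
  haveI h0 : IsLocalization.AtPrime (Localization.AtPrime (coneLocalPrime (c j) hcj P)) (conePrime (c j) hcj P) :=
    isLocalization_atPrime_localization_map_of_le (fibreConeVertex (𝔭))
      (conePrime_le_fibreConeVertex (c j) hcj P hP)
  exact isLocalization_atPrime_comap_of_ringEquiv (fibreConeQuotEquiv c) (conePrime (c j) hcj P)
    ((chartConePrime c j P).map (Ideal.Quotient.mk (fibreConeIdeal c)))
    (comap_fibreConeQuotEquiv_conePrime c j P).symm (L := Localization.AtPrime (coneLocalPrime (c j) hcj P))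

/-- **`FibreConeLocal 𝔭` is the local ring of the coordinate cone at its vertex**: a localization of `k[Y]/I(c)` at
the origin `(Y)/I(c)`. [folklore] -/
theorem isLocalization_atPrime_fibreConeLocal :
    haveI := isMaximal_map_ker_eval_zero_fibreConeIdeal c
    letI := algebraOfFibreCone c (FibreConeLocal (𝔭))
    IsLocalization.AtPrime (FibreConeLocal (𝔭))
      ((RingHom.ker (eval (0 : Fin n → ResidueField O))).map (Ideal.Quotient.mk (fibreConeIdeal c))) := by
  haveI := isMaximal_map_ker_eval_zero_fibreConeIdeal c
  exact isLocalization_atPrime_comap_of_ringEquiv (fibreConeQuotEquiv c) (fibreConeVertex (𝔭))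
    ((RingHom.ker (eval (0 : Fin n → ResidueField O))).map (Ideal.Quotient.mk (fibreConeIdeal c)))
    (comap_fibreConeQuotEquiv_fibreConeVertex c).symm (L := FibreConeLocal (𝔭))

end ChartCone

/-! ## Dimensions: `dim k[Y]/𝔓(P) = dim (FibreConeLocal 𝔭 ⧸ coneLocalPrime)` -/

section Dimension

variable {K : Type u} [Field K] {n : ℕ}

/-- **`dim 𝒪_{C,𝔮}/𝔓𝒪_{C,𝔮} = dim S/𝔓`** for `I ⊆ 𝔓 ⊆ 𝔮`, `𝔮` maximal, `S = K[X]` (equidimensionality of the affine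
domain `S/𝔓`: `ht(𝔮/𝔓) = dim S/𝔓`). [cite: Matsumura1987, §5 Thm. 5.6 and Ex. 5.1] -/
theorem ringKrullDim_localization_quotient_eq_ringKrullDim {I 𝔓 𝔮 : Ideal (MvPolynomial (Fin n) K)} [𝔓.IsPrime]
    [𝔮.IsMaximal] (hI𝔓 : I ≤ 𝔓) (h𝔓𝔮 : 𝔓 ≤ 𝔮) :
    haveI := isMaximal_map_mk_of_le ‹𝔮.IsMaximal› (hI𝔓.trans h𝔓𝔮)
    ringKrullDim (Localization.AtPrime (𝔮.map (Ideal.Quotient.mk I)) ⧸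
      (𝔓.map (Ideal.Quotient.mk I)).map
        (algebraMap (MvPolynomial (Fin n) K ⧸ I) (Localization.AtPrime (𝔮.map (Ideal.Quotient.mk I))))) =
      ringKrullDim (MvPolynomial (Fin n) K ⧸ 𝔓) := by
  haveI := isMaximal_map_mk_of_le ‹𝔮.IsMaximal› (hI𝔓.trans h𝔓𝔮)
  haveI := isPrime_map_quotientMk_of_le hI𝔓
  rw [ringKrullDim_localization_quotient_map_map hI𝔓 (𝔮.map (Ideal.Quotient.mk I)) (Ideal.map_mono h𝔓𝔮)]
  set T := MvPolynomial (Fin n) K ⧸ I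
  set P' : Ideal T := 𝔓.map (Ideal.Quotient.mk I)
  haveI : IsDomain (T ⧸ P') := Ideal.Quotient.isDomain P'
  haveI hmax : ((𝔮.map (Ideal.Quotient.mk I)).map (Ideal.Quotient.mk P')).IsMaximal := by
    have hsurj : Function.Surjective ((Ideal.Quotient.mk P').comp (Ideal.Quotient.mk I)) :=
      Ideal.Quotient.mk_surjective.comp Ideal.Quotient.mk_surjective
    rw [Ideal.map_map]
    refine (Ideal.map_eq_top_or_isMaximal_of_surjective _ hsurj ‹𝔮.IsMaximal›).resolve_left
      fun htop => ‹𝔮.IsMaximal›.ne_top ?_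
    have h := Ideal.comap_map_of_surjective _ hsurj 𝔮
    have hker : RingHom.ker ((Ideal.Quotient.mk P').comp (Ideal.Quotient.mk I)) = 𝔓 := by
      rw [← RingHom.comap_ker, Ideal.mk_ker, Ideal.comap_map_of_surjective _ Ideal.Quotient.mk_surjective,
        ← RingHom.ker_eq_comap_bot, Ideal.mk_ker, sup_eq_left.mpr hI𝔓]
    rw [htop, Ideal.comap_top, ← RingHom.ker_eq_comap_bot, hker, sup_eq_left.mpr h𝔓𝔮] at h
    exact h.symm
  rw [height_eq_ringKrullDim_of_isMaximal K ((𝔮.map (Ideal.Quotient.mk I)).map (Ideal.Quotient.mk P')),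
    ringKrullDim_eq_of_ringEquiv (DoubleQuot.quotQuotEquivQuotOfLE hI𝔓)]

variable {O : Type u} [CommRing O] [IsLocalRing O] (c : Fin n → O) (j : Fin n)

local notation3 "𝔭" => Ideal.span (Set.range c)
local notation3 "hcj" => Ideal.mem_span_range_self (f := c) (x := j)

variable (P : Ideal (chartRing c j)) [P.IsPrime]

/-- **`dim k[Y]/𝔓(P) = dim (FibreConeLocal 𝔭 ⧸ coneLocalPrime)`**: the `d` of the Bennett–Hironaka–Singh chain read on the
coordinate cone. [folklore] -/
theorem ringKrullDim_quotient_chartConePrime_eq (hP : P.comap (chartBase c j) = maximalIdeal O) :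
    haveI := isPrime_coneLocalPrime (c j) hcj P hP
    ringKrullDim (MvPolynomial (Fin n) (ResidueField O) ⧸ chartConePrime c j P) =
      ringKrullDim (FibreConeLocal (𝔭) ⧸ coneLocalPrime (c j) hcj P) := by
  haveI := isPrime_coneLocalPrime (c j) hcj P hP
  haveI := isPrime_conePrime (c j) hcj P hP
  haveI := isPrime_chartConePrime c j P hP
  haveI := isMaximal_map_ker_eval_zero_fibreConeIdeal c
  set I := fibreConeIdeal c
  have hI𝔓 : I ≤ chartConePrime c j P := fibreConeIdeal_le_chartConePrime c j P
  have h𝔓𝔐 : chartConePrime c j P ≤ RingHom.ker (eval (0 : Fin n → ResidueField O)) := by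
    rw [← comap_fibreConePolyMap_fibreConeVertex c]
    exact Ideal.comap_mono (conePrime_le_fibreConeVertex (c j) hcj P hP)
  haveI : (RingHom.ker (eval (0 : Fin n → ResidueField O))).IsMaximal :=
    RingHom.ker_isMaximal_of_surjective (eval (0 : Fin n → ResidueField O)) fun a => ⟨C a, eval_C a⟩
  rw [← ringKrullDim_localization_quotient_eq_ringKrullDim hI𝔓 h𝔓𝔐]
  -- `FibreConeLocal 𝔭 ≅ (k[Y]/I(c))_{(Y)/I(c)}` as `k[Y]/I(c)`-algebras, carrying `coneLocalPrime` to `𝔓(P)·(…)`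
  letI algL := algebraOfFibreCone c (FibreConeLocal (𝔭))
  haveI hloc := isLocalization_atPrime_fibreConeLocal c
  set J : Ideal (MvPolynomial (Fin n) (ResidueField O) ⧸ I) :=
    (RingHom.ker (eval (0 : Fin n → ResidueField O))).map (Ideal.Quotient.mk I)
  let φ : FibreConeLocal (𝔭) ≃ₐ[MvPolynomial (Fin n) (ResidueField O) ⧸ I] Localization.AtPrime J :=
    IsLocalization.algEquiv J.primeCompl (FibreConeLocal (𝔭)) (Localization.AtPrime J)
  have hq : coneLocalPrime (c j) hcj P =
      ((chartConePrime c j P).map (Ideal.Quotient.mk I)).map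
        ((algebraMap (FibreCone (𝔭)) (FibreConeLocal (𝔭))).comp (fibreConeQuotEquiv c).toRingHom) := by
    rw [← Ideal.map_map, ← comap_fibreConeQuotEquiv_conePrime c j P,
      Ideal.map_comap_of_surjective (fibreConeQuotEquiv c).toRingHom (fibreConeQuotEquiv c).surjective]
    rfl
  have hq' : (coneLocalPrime (c j) hcj P).map (φ : FibreConeLocal (𝔭) →+* Localization.AtPrime J) =
      ((chartConePrime c j P).map (Ideal.Quotient.mk I)).map
        (algebraMap (MvPolynomial (Fin n) (ResidueField O) ⧸ I) (Localization.AtPrime J)) := by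
    rw [hq, Ideal.map_map]
    congr 1
    exact φ.toAlgHom.comp_algebraMap
  exact (ringKrullDim_eq_of_ringEquiv (Ideal.quotientEquiv _ _ φ.toRingEquiv hq'.symm)).symm

end Dimension

end CampaignW42

end Summit.ResolutionOfSingularities.ResolutionOfSingularities.Theorems

end
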